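import Summits.Ventures.HSemireg.Pad4FirstOrderModelChecks

/-!
# Venture HSemireg — the UNFED FLAG is dead at first order: a kernel instance family of THEOREM L^ζ's conclusion (companion of `Pad4FirstOrderModel.lean`, row 716)

HONEST FRAMING. PROVED non-degeneracy check of the first-order model (typer hodge-lit-semireg-typer g7, 2026-08-27). In
`Pad4FirstOrderModel.lean` (p505821) the obligation `TheoremLZetaMain` («a class-y design with minimal presentation and a
constituent charged on ≥ 2 factors violates `H2` = (E1)») is kernel-OPEN (`@[conjecture]`). This file proves its conclusion on
the simplest sub-family, where no partner feeds the demand (THEOREM P's diagonal criterion itself fails — PAD4-FIRSTORDER §0,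
PAD4-DIAGCLOSURE §0 «(D_X) unfed»): for ANY constituent `X` charged on two factors `σ < f` (anything on the other factors) and
any uncharged `U` in `X`'s layer, in the design `E₋ = X ⊕ U⁴`, `E₊ = U` the `X`-column of `φ ∘ η = ob_κ(E₋)` is unsolvable at
`κ₀ = E_{fσ}` for EVERY choice of sections `φ` (`lowerColumn_unsolvable_unfedFlag`), hence `¬ H2` (`not_H2_unfedFlag`), and
a concrete class-y instance exists (`exists_classY_forall_not_H2`). MECHANISM (the cell's THEOREM P in the kernel, smallest
case): the only unknown is `η_U ∈ H²(U − X)`; on the factors `σ`, `f` the product with the section `φ_{XU} ∈ H⁰(X − U)` is the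
evaluation pairing `H¹(−cℓ_ζ) × H⁰(cℓ_ζ) → Ξ_ζ` (`coef_neg_one_pos_self`), so the image of the column map in the
`V_σ ⊗ V_f`-component of the demand row lies on the line `ξ̄_{ζ_σ} ⊗ ξ̄_{ζ_f}`: its coordinates at `ē_{B,σ} ⊗ ē_{A,f}` and
`ē_{A,σ} ⊗ ē_{A,f}` are in the ratio `ζ̄_σ : 1` (the `hprop` step); the demand `ob_{κ₀}(X)` has those coordinates `0` and
`−c_f ζ_f` (`ob_qPair`, the closed form of the model's `ob` on a pair of factors) — contradiction since `ζ̄_σ c_f ζ_f ≠ 0`.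
WHAT THIS IS NOT: the conjecture's content lies in designs that PASS the diagonal criterion (D₅₅, D₄₅-type, fed demands,
off-diagonal rows (R1)(R2)); nothing here touches them, nothing is TIER 2 (director-hodge g7 l.29811 «NOT now»), nothing here
says HC ∕ HC_CM ∕ HC_AV holds; no fact, no definition, no instance, no notation. With `Pad4FirstOrderModelMinimalNecessary.lean`
(row 737: `H2` CAN hold once `Minimal` is dropped) this shows the model's (E1) is degenerate in NEITHER direction.
Imports the row-731 companion (`rel_self`, `coefProd_eq_mul_erase`). SOURCES as in the model file. Typed ≠ proved ≠ endorsed.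
-/

noncomputable section
namespace Summit.Ventures.HSemireg.Pad4FirstOrder
open Finset

/-! ## The demand on a pair of factors, in closed form -/

/-- `qPair σ f` (degree `1` on `σ` and on `f`) is never a `Λ²`-distribution `single g 2`. -/
theorem qPair_ne_single (σ f g : Fin 4) : qPair σ f ≠ Pi.single g 2 := by
  revert σ f g; decide

/-- `qPair` is symmetric. -/
theorem qPair_comm (σ f : Fin 4) : qPair σ f = qPair f σ := by
  revert σ f; decide

/-- two pair distributions agree only for the same unordered pair. -/
theorem qPair_eq_qPair (σ f f' τ : Fin 4) (hσf : σ ≠ f) (h : qPair σ f = qPair f' τ) :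
    (f' = σ ∧ τ = f) ∨ (f' = f ∧ τ = σ) := by
  revert σ f f' τ; decide

/-- the `(f′, τ)`-summand of the demand `ob` read at the distribution `qPair σ f` vanishes unless `{f′, τ} = {σ, f}`. -/
theorem obSummand_eq_zero (X : Constituent) (κ : Matrix (Fin 4) (Fin 4) ℂ) (σ f : Fin 4) (hne : σ ≠ f)
    (o : Fin 4 → ℕ × ℕ) (f' τ : Fin 4) (h : ¬((f' = σ ∧ τ = f) ∨ (f' = f ∧ τ = σ))) :
    (X.charge f' : ℂ) *
      (if τ = f' then
        (if qPair σ f = Pi.single f' 2 then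
          xiBar (X.phase f') (0, 0) * kap κ (X.phase f') f' f' (1, 0) -
            xiBar (X.phase f') (1, 0) * kap κ (X.phase f') f' f' (0, 0)
         else 0)
       else if qPair σ f = qPair f' τ then
        (if f' < τ then xiBar (X.phase f') (o f') * kap κ (X.phase f') f' τ (o τ)
         else -(kap κ (X.phase f') f' τ (o τ) * xiBar (X.phase f') (o f')))
       else 0) = 0 := by
  by_cases hτ : τ = f'
  · rw [if_pos hτ, if_neg (qPair_ne_single σ f f'), mul_zero]
  · rw [if_neg hτ, if_neg (fun hq => h (qPair_eq_qPair σ f f' τ hne hq)), mul_zero]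

/-- **CLOSED FORM OF THE DEMAND ON A PAIR OF FACTORS**: for `σ < f`, the `V_σ ⊗ V_f`-component of
`ob_κ(X) = Σ_g c_g ξ̄_{ζ_g} ∧ κ(ξ_{ζ_g})` is `c_σ · ξ̄_{ζ_σ} ⊗ κ(ξ_{ζ_σ})_f − c_f · κ(ξ_{ζ_f})_σ ⊗ ξ̄_{ζ_f}`
(PAD4-DIAGCLOSURE §0; the definition's double sum collapsed to its two surviving terms). -/
theorem ob_qPair (X : Constituent) (κ : Matrix (Fin 4) (Fin 4) ℂ) (σ f : Fin 4) (hσf : σ < f) (o : Fin 4 → ℕ × ℕ) :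
    ob X κ (qPair σ f) o =
      (X.charge σ : ℂ) * (xiBar (X.phase σ) (o σ) * kap κ (X.phase σ) σ f (o f)) -
        (X.charge f : ℂ) * (kap κ (X.phase f) f σ (o σ) * xiBar (X.phase f) (o f)) := by
  have hne : σ ≠ f := ne_of_lt hσf
  have hnf : ¬ f < σ := not_lt.mpr (le_of_lt hσf)
  unfold ob
  rw [Finset.sum_eq_add_of_mem σ f (mem_univ _) (mem_univ _) hne (fun f' _ hf' =>
    Finset.sum_eq_zero fun τ _ => obSummand_eq_zero X κ σ f hne o f' τ
      (by rintro (⟨h1, -⟩ | ⟨h1, -⟩) <;> [exact hf'.1 h1; exact hf'.2 h1]))]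
  rw [Finset.sum_eq_single_of_mem f (mem_univ _) (fun τ _ hτ => obSummand_eq_zero X κ σ f hne o σ τ
      (by rintro (⟨-, h1⟩ | ⟨h1, -⟩) <;> [exact hτ h1; exact hne h1])),
    Finset.sum_eq_single_of_mem σ (mem_univ _) (fun τ _ hτ => obSummand_eq_zero X κ σ f hne o f τ
      (by rintro (⟨h1, -⟩ | ⟨-, h1⟩) <;> [exact hne h1.symm; exact hτ h1]))]
  rw [if_neg hne.symm, if_pos rfl, if_pos hσf, if_neg hne, if_pos (qPair_comm σ f), if_neg hnf]
  ring

/-! ## The unfed flag -/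

/-- the `σ`-erased part of `coefProd` does not see the `σ`-coordinate of the TARGET index `o`. -/
theorem prod_erase_update_target (rU rS : Fin 4 → Rel) (q : Fin 4 → ℕ) (ι a o : Fin 4 → ℕ × ℕ) (σ : Fin 4) (v : ℕ × ℕ) :
    ∏ g ∈ univ.erase σ, coef (rU g) (q g) (ι g) (rS g) (a g) (Function.update o σ v g) =
      ∏ g ∈ univ.erase σ, coef (rU g) (q g) (ι g) (rS g) (a g) (o g) := by
  refine Finset.prod_congr rfl fun g hg => ?_
  rw [Function.update_of_ne (Finset.ne_of_mem_erase hg)]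

/-- the class of `U − X` on a factor where `U` is uncharged and `X` charged (same layer): the negative letter of `X`. -/
theorem rel_uncharged_charged (U X : Constituent) (g : Fin 4) (hl : U.layer = X.layer) (hU : U.charge g = 0)
    (hX : X.charge g ≠ 0) : rel U X g = Rel.neg (X.charge g) (X.phase g) := by
  unfold rel
  rw [if_neg (not_not.mpr hl), if_neg (fun h => hX h.2), if_neg hX, if_pos hU]

/-- … and `X − U` there: the positive letter of `X`. -/
theorem rel_charged_uncharged (X U : Constituent) (g : Fin 4) (hl : U.layer = X.layer) (hU : U.charge g = 0)
    (hX : X.charge g ≠ 0) : rel X U g = Rel.pos (X.charge g) (X.phase g) := by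
  unfold rel
  rw [if_neg (not_not.mpr hl.symm), if_neg (fun h => hX h.1), if_pos hU]

/-- the evaluation pairing `H¹(−c ℓ_ζ) × H⁰(c ℓ_ζ) → H¹(O) = Ξ_ζ`: the unknown coordinate `ι` against the section monomial `a`
lands on the line `ξ̄_ζ` — coordinate `o` of `V` reads `[a = ι] · ξ̄_ζ(o)` (PAD4-LEAK §1 «evaluation»). -/
theorem coef_neg_one_pos_self (c : ℕ) (k : Fin 4) (ι a o : ℕ × ℕ) :
    coef (Rel.neg c k) 1 ι (Rel.pos c k) a o = if a = ι then xiBar k o else 0 := by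
  simp [coef]

/-- membership of the pair-distribution coordinates of `H²(X − X) = H²(O)` used below. -/
theorem qPair_mem_qDist2 (σ f : Fin 4) (h : σ ≠ f) : qPair σ f ∈ qDist2 := by
  revert σ f; decide

/-- the coordinates `(qPair σ f, o)` of `H²(X − X) = H²(O)` with `o` supported on `ē_A ∕ ē_B` at `σ, f` and on `ē_A` elsewhere. -/
theorem mem_idxH2_self_qPair (X : Constituent) (σ f : Fin 4) (hσf : σ ≠ f) (o : Fin 4 → ℕ × ℕ)
    (ho : ∀ g, o g = (0, 0) ∨ (o g = (1, 0) ∧ (g = σ ∨ g = f))) : (qPair σ f, o) ∈ idxH2 X X := by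
  unfold idxH2
  refine Finset.mem_biUnion.mpr ⟨qPair σ f, qPair_mem_qDist2 σ f hσf, Finset.mem_image.mpr ⟨o, ?_, rfl⟩⟩
  refine Fintype.mem_piFinset.mpr fun g => ?_
  rw [rel_self]
  rcases ho g with h0 | ⟨h1, hg⟩
  · rw [h0]; simp only [qPair]; split_ifs <;> simp [idx]
  · rw [h1]
    have : qPair σ f g = 1 := by simp only [qPair]; rw [if_pos hg]
    rw [this]; simp [idx]

/-- **THE UNFED FLAG IS DEAD AT FIRST ORDER** (THEOREM P's demand with no partner to feed it; the first kernel instance of the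
mechanism behind THEOREM L^ζ): let `X` be charged on two factors `σ < f` (anything on the others) and `U` an uncharged
constituent in `X`'s layer; in the design `E₋ = X ⊕ U⁴`, `E₊ = U` the `X`-column of `φ ∘ η = ob_κ(E₋)` is UNSOLVABLE at
`κ₀ = E_{fσ}` (`k_{fσ} = 1`) for EVERY choice of sections `φ`: the only unknown is `η_U ∈ H²(U − X)`, whose image in the
`V_σ ⊗ V_f`-component of the demand row lies on the line `ξ̄_{ζ_σ} ⊗ ξ̄_{ζ_f}` (evaluation pairing on both factors,
`coef_neg_one_pos_self`), while `ob_{κ₀}(X)` has the coordinate `−c_f ζ_f` at `ē_{A,σ} ⊗ ē_{A,f}` and `0` at `ē_{B,σ} ⊗ ē_{A,f}`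
(`ob_qPair`) — not proportional to `(1, ζ̄_σ)`. -/
theorem lowerColumn_unsolvable_unfedFlag (X U : Constituent) (σ f : Fin 4) (hσf : σ < f) (hσ : X.charge σ ≠ 0)
    (hf : X.charge f ≠ 0) (hU : ∀ g, U.charge g = 0) (hl : U.layer = X.layer)
    (φ : (Design.mk [X, U, U, U, U] [U]).Sections) :
    ¬ (Design.mk [X, U, U, U, U] [U]).LowerColumnSolvable φ
        (Matrix.of fun a b => if a = f ∧ b = σ then (1 : ℂ) else 0) ⟨0, Nat.succ_pos 4⟩ := by
  have hne : σ ≠ f := ne_of_lt hσf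
  rintro ⟨η, hη⟩
  -- the two coordinates of the demand row we read: `o₂ = (ē_A, ē_A)`, `o₁ = (ē_B at σ, ē_A at f)`
  let o₂ : Fin 4 → ℕ × ℕ := fun _ => (0, 0)
  let o₁ : Fin 4 → ℕ × ℕ := Function.update o₂ σ (1, 0)
  have ho₂ : (qPair σ f, o₂) ∈ idxH2 X X := mem_idxH2_self_qPair X σ f hne o₂ fun _ => Or.inl rfl
  have ho₁ : (qPair σ f, o₁) ∈ idxH2 X X := mem_idxH2_self_qPair X σ f hne o₁ fun g => by
    by_cases hg : g = σ
    · subst hg; exact Or.inr ⟨Function.update_self .., Or.inl rfl⟩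
    · exact Or.inl (Function.update_of_ne hg ..)
  have h₂ := hη ⟨0, Nat.succ_pos 4⟩ (qPair σ f, o₂) ho₂
  have h₁ := hη ⟨0, Nat.succ_pos 4⟩ (qPair σ f, o₁) ho₁
  rw [if_pos rfl] at h₁ h₂
  -- the demand at the two coordinates
  have hob₂ : ob X (Matrix.of fun a b => if a = f ∧ b = σ then (1 : ℂ) else 0) (qPair σ f) o₂ =
      -((X.charge f : ℂ) * zetaC (X.phase f)) := by
    rw [ob_qPair X _ σ f hσf]
    simp [kap, xiBar, o₂, hne, hne.symm]
  have hob₁ : ob X (Matrix.of fun a b => if a = f ∧ b = σ then (1 : ℂ) else 0) (qPair σ f) o₁ = 0 := by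
    rw [ob_qPair X _ σ f hσf]
    simp [kap, xiBar, o₁, o₂, hne, hne.symm]
  -- the left-hand sides at the two coordinates are proportional: `LHS(o₁) = ζ̄_σ · LHS(o₂)`
  have hprop : (Design.mk [X, U, U, U, U] [U]).lowerLHS φ η ⟨0, Nat.succ_pos 4⟩ ⟨0, Nat.succ_pos 4⟩ (qPair σ f, o₁) =
      zetaBar (X.phase σ) *
        (Design.mk [X, U, U, U, U] [U]).lowerLHS φ η ⟨0, Nat.succ_pos 4⟩ ⟨0, Nat.succ_pos 4⟩ (qPair σ f, o₂) := by
    simp only [Design.lowerLHS, Finset.mul_sum]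
    refine Finset.sum_congr rfl fun j _ => Finset.sum_congr rfl fun u _ => Finset.sum_congr rfl fun a _ => ?_
    have hPj : (Design.mk [X, U, U, U, U] [U]).P j = U := by
      have : j = ⟨0, Nat.one_pos⟩ := by ext; have : j.val < 1 := j.isLt; simp only; omega
      subst this; rfl
    have hN0 : (Design.mk [X, U, U, U, U] [U]).N ⟨0, Nat.succ_pos 4⟩ = X := rfl
    rw [hPj, hN0]
    by_cases hu : u.1 = qPair σ f
    · rw [if_pos hu, if_pos hu, coefProd_eq_mul_erase _ _ _ _ _ o₁ σ, coefProd_eq_mul_erase _ _ _ _ _ o₂ σ,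
        prod_erase_update_target, rel_uncharged_charged U X σ hl (hU σ) hσ, rel_charged_uncharged X U σ hl (hU σ) hσ]
      have hq : qPair σ f σ = 1 := by simp [qPair]
      rw [hq, coef_neg_one_pos_self, coef_neg_one_pos_self]
      have e1 : xiBar (X.phase σ) (o₁ σ) = zetaBar (X.phase σ) := by simp [o₁, xiBar]
      have e0 : xiBar (X.phase σ) (o₂ σ) = 1 := by simp [o₂, xiBar]
      rw [e1, e0]
      by_cases ha : a σ = u.2 σ
      · rw [if_pos ha, if_pos ha]; ring
      · rw [if_neg ha, if_neg ha]; ring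
    · rw [if_neg hu, if_neg hu]; ring
  -- conclude: `ζ̄_σ · (−c_f ζ_f) = 0`, impossible
  have e₂ : (Design.mk [X, U, U, U, U] [U]).lowerLHS φ η ⟨0, Nat.succ_pos 4⟩ ⟨0, Nat.succ_pos 4⟩ (qPair σ f, o₂) =
      -((X.charge f : ℂ) * zetaC (X.phase f)) := h₂.trans hob₂
  have e₁ : (Design.mk [X, U, U, U, U] [U]).lowerLHS φ η ⟨0, Nat.succ_pos 4⟩ ⟨0, Nat.succ_pos 4⟩ (qPair σ f, o₁) = 0 :=
    h₁.trans hob₁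
  have key : zetaBar (X.phase σ) * -((X.charge f : ℂ) * zetaC (X.phase f)) = 0 := by
    rw [← e₂]; exact hprop.symm.trans e₁
  have hz : zetaBar (X.phase σ) ≠ 0 := inv_ne_zero (pow_ne_zero _ Complex.I_ne_zero)
  have hzf : zetaC (X.phase f) ≠ 0 := pow_ne_zero _ Complex.I_ne_zero
  have hcf : (X.charge f : ℂ) ≠ 0 := Nat.cast_ne_zero.mpr hf
  exact (mul_ne_zero hz (neg_ne_zero.mpr (mul_ne_zero hcf hzf))) key

/-- Hence **(E1) FAILS for the unfed flag, for every choice of sections** — `TheoremLZetaMain`'s conclusion on this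
sub-family (where it is THEOREM P's diagonal criterion that fails; the conjecture's content lies in designs that pass it,
D₅₅ ∕ D₄₅-type, untouched here). In particular the model's `H2` is not degenerate: it can fail. -/
theorem not_H2_unfedFlag (X U : Constituent) (σ f : Fin 4) (hσf : σ < f) (hσ : X.charge σ ≠ 0) (hf : X.charge f ≠ 0)
    (hU : ∀ g, U.charge g = 0) (hl : U.layer = X.layer) (φ : (Design.mk [X, U, U, U, U] [U]).Sections) :
    ¬ (Design.mk [X, U, U, U, U] [U]).H2 φ := fun h =>
  lowerColumn_unsolvable_unfedFlag X U σ f hσf hσ hf hU hl φ ((h _).1 ⟨0, Nat.succ_pos 4⟩)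

/-- **a class-y design on which THEOREM L^ζ's conclusion is a kernel theorem for ALL sections**: `E₋ = X ⊕ O⁴`, `E₊ = O`,
`X = ℓ₁^{(0)} + ℓ₁^{(1)}` — `#N = #P + 4`, a constituent charged on two factors, and `¬ H2` for every `φ` (minimal or not). -/
theorem exists_classY_forall_not_H2 :
    ∃ D : Design, D.InClassY ∧ (∃ X ∈ D.lower ++ D.upper, 2 ≤ X.nCharged) ∧ ∀ φ : D.Sections, ¬ D.H2 φ := by
  refine ⟨Design.mk [⟨0, fun g => if g.val < 2 then 1 else 0, fun _ => 0⟩, ⟨0, fun _ => 0, fun _ => 0⟩,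
      ⟨0, fun _ => 0, fun _ => 0⟩, ⟨0, fun _ => 0, fun _ => 0⟩, ⟨0, fun _ => 0, fun _ => 0⟩]
      [⟨0, fun _ => 0, fun _ => 0⟩], rfl, ⟨⟨0, fun g => if g.val < 2 then 1 else 0, fun _ => 0⟩, by simp, ?_⟩, ?_⟩
  · unfold Constituent.nCharged; decide
  · exact not_H2_unfedFlag _ _ 0 1 (by decide) (by simp) (by simp) (fun _ => rfl) rfl

end Summit.Ventures.HSemireg.Pad4FirstOrder

end
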